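import Summits.AtomisticToContinuum.Crystallization.Theorems.FrustratedLawDichotomyStrainedPatchHomLeafTableDataCertHcp
import Summits.AtomisticToContinuum.Crystallization.Theorems.FrustratedLawDichotomyStrainedPatchHomLeafTableDataCertK1b
import Summits.AtomisticToContinuum.Crystallization.Theorems.FrustratedLawDichotomyStrainedPatchHomLeafTableDataCertK2
import Summits.AtomisticToContinuum.Crystallization.Theorems.FrustratedLawDichotomyStrainedPatchHomLeafTableDataCertK3
import Summits.AtomisticToContinuum.Crystallization.Theorems.FrustratedLawDichotomyStrainedPatchHomLeafTableDataCertK4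
import Summits.AtomisticToContinuum.Crystallization.Theorems.FrustratedLawDichotomyStrainedPatchHomEntryFlipHcp
import Summits.AtomisticToContinuum.Crystallization.Theorems.FrustratedLawDichotomyStrainedPatchHomEntrySymBox

/-!
# ENTRY-COORDINATE hcp TABLE LEAF (β2-hcp) and ★★★ the `(H)` target certificate v5 `homFloor_625_of_entrySearches6RB3RDT`

decomp-a2c hand-2 g24 (crux `AperiodicFrustratedLawGap`, stmt-AtomisticToContinuum-27623; critic rows 864/865 job one).

* §1 `tabLH c w : LH` — the ten SIGNED class centres / class half-widths of hand-2's (entries, shuffle) → extended-Gram interval map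
  `…HomEntryGramHcp.extC / extW` (13 coordinates summed into the 10 classes; centres sign–magnitude, widths `toNat`), and ★ `tabLH_mem_box` (the `hbox`
  hypothesis of `boxSumH_ge_of_leafCheckH`, from `ext_mem_box`);
* §2 `tableLeafOKHW tab E μ c w := shufInOK c w ∧ leafCheckH tab nearLabelsH E tabHA0…9 (tabLH c w) (μ < 0) (2|μ|)` (ANY table; the v2 instance
  `tableLeafOKH μ := tableLeafOKHW qTable tabE μ`) — the guard `shufInOK`
  (`|cᵢ| + wᵢ ≤ SC/4` on the three shuffle coordinates, true on every box of the root cube) supplies `|ξᵢ| ≤ 1/4` for the shifted far labels; the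
  doubled target cancels hand-1's `±`-half-set factor — and ★ `tableLeafOKHW_sound` in the `hver` shape of `…HomEntryGramHcp.hcpHalf_of_entryTree`, for
  every SEMANTICALLY certified table (`TabSem`: v2 `qTable_allOK`, or hand-1's v3 "K" rows via `tabSem_of_allOKK` — the hcp leaf is row-version-agnostic);
* §3 the nine-coordinate driver `entryLeafOKHTW tab E μ := tableLeafOKHW tab E μ ∘ symH`, the verdict v5
  `entryLeafOKH3RDTW tab E μ := shufOut ∨ radOKH ∘ symH ∨ TABLE ∨ entryLeafOKH3R μ` (cheap prunes, then the TABLE, then the v4 rest) and its instance of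
  record `entryLeafOKH3RDT μ` (v2 table), `hver` soundness over the fundamental domain, `hcpHalf_of_entrySearchH3RDT(W)`, and ★★★
  `homFloor_625_of_entrySearches6RB3RDT` / `…6R3RDT` (+ milli twin, + the any-table form `homFloor_of_entrySearches6RB3RDTW`): `HomFloor (1/625)` from the
  fcc search of record and ONE hcp search Boolean with the table leaf.
* §4 ★ the TIERED verdict `entryLeafOKH3RDTK μ` over hand-1 g22's four v3 "K" tables `qTableK1…4` (certificates `qTableKn_allOKK`, all in the tree),
  its soundness, `hcpHalf_of_entrySearchH3RDTK`, and ★★★ `homFloor_625_of_entrySearches6RB3RDTK` (+ milli).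
All definitions computable; 0 sorry; standard axioms.  `--supports stmt-AtomisticToContinuum-27623`.
-/

namespace Summit.AtomisticToContinuum.Crystallization.Theorems.FrustratedLawDichotomyStrainedPatchHomEntryTableHcp

open scoped BigOperators RealInnerProductSpace
open Literature.Analysis.ValidatedNumerics.Numerics
open Summit.AtomisticToContinuum.Crystallization.Theorems.ChargedEnergyGapNegative (E3)
open Summit.AtomisticToContinuum.Crystallization.Theorems.FrustratedLawDichotomySchurCut (effPot w₄₅ ω₄)
open Summit.AtomisticToContinuum.Crystallization.Theorems.FrustratedLawDichotomyAveragingRuleTightFree (TightNearCap BadNearCap)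
open Summit.AtomisticToContinuum.Crystallization.Theorems.FrustratedLawDichotomyExemptAbsorption (ExemptNear)
open Summit.AtomisticToContinuum.Crystallization.Theorems.FrustratedLawDichotomyStrainedPatchHomSplit
open Summit.AtomisticToContinuum.Crystallization.Theorems.FrustratedLawDichotomyStrainedPatchHomPrunedPolar (homFloor_of_prunedBoxSums_selfAdjoint)
open Summit.AtomisticToContinuum.Crystallization.Theorems.FrustratedLawDichotomyStrainedPatchHomEntryGram (abs_sub_cen_le rootC rootW rootW_div)
open Summit.AtomisticToContinuum.Crystallization.Theorems.FrustratedLawDichotomyStrainedPatchHomEntryGramHcp (extFI extC extW ext_mem_box rootCH rootWH)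
open Summit.AtomisticToContinuum.Crystallization.Theorems.FrustratedLawDichotomyStrainedPatchHomEntryTable (muRec muRec_ok sgnZ_natAbs)
open Summit.AtomisticToContinuum.Crystallization.Theorems.FrustratedLawDichotomyStrainedPatchHomEntrySearch (searchOK exists_tree_of_searchOK)
open Summit.AtomisticToContinuum.Crystallization.Theorems.FrustratedLawDichotomyStrainedPatchHomEntrySix (muMilli muMilli_ok)
open Summit.AtomisticToContinuum.Crystallization.Theorems.FrustratedLawDichotomyStrainedPatchHomEntryRadial (entryLeafOK6R fccHalf_of_entrySearch6R)
open Summit.AtomisticToContinuum.Crystallization.Theorems.FrustratedLawDichotomyStrainedPatchHomEntrySixHcpSharp (entryLeafOK6RB fccHalf_of_entrySearch6RB)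
open Summit.AtomisticToContinuum.Crystallization.Theorems.FrustratedLawDichotomyStrainedPatchHomEntryRadialHcp (radOKH radOKH_sound entryLeafOKH3R entryLeafOKH3R_sound)
open Summit.AtomisticToContinuum.Crystallization.Theorems.FrustratedLawDichotomyStrainedPatchHomEntrySymBox (symH hbox_symU)
open Summit.AtomisticToContinuum.Crystallization.Theorems.FrustratedLawDichotomyStrainedPatchHomEntryFlipHcp
  (HcpDich shufOut false_of_shufOut hcpHalf_of_entrySearchShuf)
open Summit.AtomisticToContinuum.Crystallization.Theorems.FrustratedLawDichotomyStrainedPatchHomLeafTableCheck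
  (QT sgnZ qTable tabE qTable_allOK qTableK1 qTableK2 qTableK3 qTableK4 qTableK1_allOKK qTableK2_allOKK qTableK3_allOKK qTableK4_allOKK)
open Summit.AtomisticToContinuum.Crystallization.Theorems.FrustratedLawDichotomyStrainedPatchHomLeafTableCheckHcp

/-! ## §1. The class data of an entry/shuffle box -/

/-- The ten INTEGER class centres of the box: class sums of `extC`. -/
def zC (c w : (Fin 3 × Fin 3) ⊕ Fin 3 → ℤ) : Fin 10 → ℤ :=
  ![extC c w (Sum.inl (0, 0)), extC c w (Sum.inl (1, 1)), extC c w (Sum.inl (2, 2)),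
    extC c w (Sum.inl (0, 1)) + extC c w (Sum.inl (1, 0)), extC c w (Sum.inl (0, 2)) + extC c w (Sum.inl (2, 0)),
    extC c w (Sum.inl (1, 2)) + extC c w (Sum.inl (2, 1)),
    extC c w (Sum.inr (Sum.inl 0)), extC c w (Sum.inr (Sum.inl 1)), extC c w (Sum.inr (Sum.inl 2)), extC c w (Sum.inr (Sum.inr 0))]

/-- The ten INTEGER class half-widths of the box: class sums of `extW`. -/
def zW (c w : (Fin 3 × Fin 3) ⊕ Fin 3 → ℤ) : Fin 10 → ℤ :=
  ![extW c w (Sum.inl (0, 0)), extW c w (Sum.inl (1, 1)), extW c w (Sum.inl (2, 2)),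
    extW c w (Sum.inl (0, 1)) + extW c w (Sum.inl (1, 0)), extW c w (Sum.inl (0, 2)) + extW c w (Sum.inl (2, 0)),
    extW c w (Sum.inl (1, 2)) + extW c w (Sum.inl (2, 1)),
    extW c w (Sum.inr (Sum.inl 0)), extW c w (Sum.inr (Sum.inl 1)), extW c w (Sum.inr (Sum.inl 2)), extW c w (Sum.inr (Sum.inr 0))]

/-- ★ The TABLE-CHECKER class data of the entry/shuffle box `(c, w)` (centres sign–magnitude, widths `toNat`). -/
def tabLH (c w : (Fin 3 × Fin 3) ⊕ Fin 3 → ℤ) : LH :=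
  ⟨(zC c w 0).natAbs, (zC c w 1).natAbs, (zC c w 2).natAbs, (zC c w 3).natAbs, (zC c w 4).natAbs, (zC c w 5).natAbs, (zC c w 6).natAbs,
   (zC c w 7).natAbs, (zC c w 8).natAbs, (zC c w 9).natAbs,
   decide (zC c w 0 < 0), decide (zC c w 1 < 0), decide (zC c w 2 < 0), decide (zC c w 3 < 0), decide (zC c w 4 < 0), decide (zC c w 5 < 0),
   decide (zC c w 6 < 0), decide (zC c w 7 < 0), decide (zC c w 8 < 0), decide (zC c w 9 < 0),
   (zW c w 0).toNat, (zW c w 1).toNat, (zW c w 2).toNat, (zW c w 3).toNat, (zW c w 4).toNat, (zW c w 5).toNat, (zW c w 6).toNat, (zW c w 7).toNat,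
   (zW c w 8).toNat, (zW c w 9).toNat⟩

/-- The signed centres of `tabLH` are the integer class centres. [formal bookkeeping] -/
theorem tabLH_cZ (c w : (Fin 3 × Fin 3) ⊕ Fin 3 → ℤ) (j : Fin 10) : (tabLH c w).cZ j = zC c w j := by
  fin_cases j <;> exact sgnZ_natAbs _

/-- The widths of `tabLH` are the `toNat`s of the integer class widths. [formal bookkeeping] -/
theorem tabLH_wN (c w : (Fin 3 × Fin 3) ⊕ Fin 3 → ℤ) (j : Fin 10) : (tabLH c w).wN j = (zW c w j).toNat := by
  fin_cases j <;> rfl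

/-- One extended-Gram coordinate in the box, width relaxed to `toNat`. [formal bookkeeping] -/
theorem coord_mem {x : ℝ} {a b : ℤ} (h : |x - (a : ℝ) / SC| ≤ (b : ℝ) / SC) : |x - (a : ℝ) / SC| ≤ ((b.toNat : ℤ) : ℝ) / SC :=
  h.trans (div_le_div_of_nonneg_right (by exact_mod_cast Int.self_le_toNat b) SC_pos.le)

/-- Two extended-Gram coordinates summed into one class. [formal bookkeeping] -/
theorem coord_mem_add {x y : ℝ} {a b a' b' : ℤ} (h : |x - (a : ℝ) / SC| ≤ (b : ℝ) / SC) (h' : |y - (a' : ℝ) / SC| ≤ (b' : ℝ) / SC) :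
    |x + y - ((a + a' : ℤ) : ℝ) / SC| ≤ (((b + b').toNat : ℤ) : ℝ) / SC := by
  have e : x + y - ((a + a' : ℤ) : ℝ) / SC = (x - (a : ℝ) / SC) + (y - (a' : ℝ) / SC) := by push_cast; ring
  rw [e]
  refine (abs_add_le _ _).trans ?_
  have h2 : ((b : ℝ) + b') / SC ≤ (((b + b').toNat : ℤ) : ℝ) / SC :=
    div_le_div_of_nonneg_right (by exact_mod_cast Int.self_le_toNat (b + b')) SC_pos.le
  rw [add_div] at h2
  linarith

/-- ★ **ENTRIES/SHUFFLE IN THE BOX ⟹ CLASS POINT IN `tabLH`**: exactly the `hbox` hypothesis of `boxSumH_ge_of_leafCheckH`. [folklore] -/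
theorem tabLH_mem_box (U : E3 →L[ℝ] E3) (ξ : E3) {c w : (Fin 3 × Fin 3) ⊕ Fin 3 → ℤ}
    (hbox : ∀ ab : Fin 3 × Fin 3, |(U (EuclideanSpace.single ab.2 (1 : ℝ))) ab.1 - (c (Sum.inl ab) : ℝ) / SC| ≤ (w (Sum.inl ab) : ℝ) / SC)
    (hξ : ∀ i : Fin 3, |ξ i - (c (Sum.inr i) : ℝ) / SC| ≤ (w (Sum.inr i) : ℝ) / SC) (j : Fin 10) :
    |xH U hexFrame (hcpShift + ξ) j - (((tabLH c w).cZ j : ℤ) : ℝ) / SC| ≤ (((tabLH c w).wN j : ℕ) : ℝ) / SC := by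
  have hE := ext_mem_box U ξ hbox hξ
  rw [tabLH_cZ, tabLH_wN]
  have hG : ∀ i i' : Fin 3, |⟪U (hexFrame i), U (hexFrame i')⟫ - (extC c w (Sum.inl (i, i')) : ℝ) / SC| ≤ (extW c w (Sum.inl (i, i')) : ℝ) / SC :=
    fun i i' => hE (Sum.inl (i, i'))
  have hH : ∀ i : Fin 3, |⟪U (hexFrame i), U (hcpShift + ξ)⟫ - (extC c w (Sum.inr (Sum.inl i)) : ℝ) / SC| ≤ (extW c w (Sum.inr (Sum.inl i)) : ℝ) / SC :=
    fun i => hE (Sum.inr (Sum.inl i))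
  have hT : |‖U (hcpShift + ξ)‖ ^ 2 - (extC c w (Sum.inr (Sum.inr 0)) : ℝ) / SC| ≤ (extW c w (Sum.inr (Sum.inr 0)) : ℝ) / SC := hE (Sum.inr (Sum.inr 0))
  fin_cases j
  · exact Int.toNat_natCast _ ▸ coord_mem (hG 0 0)
  · exact Int.toNat_natCast _ ▸ coord_mem (hG 1 1)
  · exact Int.toNat_natCast _ ▸ coord_mem (hG 2 2)
  · exact Int.toNat_natCast _ ▸ coord_mem_add (hG 0 1) (hG 1 0)
  · exact Int.toNat_natCast _ ▸ coord_mem_add (hG 0 2) (hG 2 0)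
  · exact Int.toNat_natCast _ ▸ coord_mem_add (hG 1 2) (hG 2 1)
  · exact Int.toNat_natCast _ ▸ coord_mem (hH 0)
  · exact Int.toNat_natCast _ ▸ coord_mem (hH 1)
  · exact Int.toNat_natCast _ ▸ coord_mem (hH 2)
  · exact Int.toNat_natCast _ ▸ coord_mem hT

/-! ## §2. The table verdict and its soundness -/

/-- Guard: the shuffle box lies inside the root cube, `[cᵢ − wᵢ, cᵢ + wᵢ] ⊆ [−SC/4, SC/4]` for the three shuffle coordinates (true on every box
the search generates; plain comparisons — no `abs`, whose lattice instance is slow in the kernel). -/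
def shufInOK (c w : (Fin 3 × Fin 3) ⊕ Fin 3 → ℤ) : Bool :=
  decide (c (Sum.inr 0) + w (Sum.inr 0) ≤ 70368744177664) && decide (-70368744177664 ≤ c (Sum.inr 0) - w (Sum.inr 0)) &&
    decide (c (Sum.inr 1) + w (Sum.inr 1) ≤ 70368744177664) && decide (-70368744177664 ≤ c (Sum.inr 1) - w (Sum.inr 1)) &&
    decide (c (Sum.inr 2) + w (Sum.inr 2) ≤ 70368744177664) && decide (-70368744177664 ≤ c (Sum.inr 2) - w (Sum.inr 2))

/-- The guard gives `|ξᵢ| ≤ 1/4`. [formal bookkeeping] -/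
theorem abs_le_of_shufInOK {c w : (Fin 3 × Fin 3) ⊕ Fin 3 → ℤ} (h : shufInOK c w = true) {ξ : E3}
    (hξ : ∀ i : Fin 3, |ξ i - (c (Sum.inr i) : ℝ) / SC| ≤ (w (Sum.inr i) : ℝ) / SC) : ∀ i : Fin 3, |ξ i| ≤ 1 / 4 := by
  have hS := SC_pos
  simp only [shufInOK, Bool.and_eq_true, decide_eq_true_eq] at h
  obtain ⟨⟨⟨⟨⟨h0, h0'⟩, h1⟩, h1'⟩, h2⟩, h2'⟩ := h
  have key : ∀ i : Fin 3, c (Sum.inr i) + w (Sum.inr i) ≤ 70368744177664 → -70368744177664 ≤ c (Sum.inr i) - w (Sum.inr i) →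
      |ξ i| ≤ 1 / 4 := by
    intro i hi hi'
    obtain ⟨hlo, hhi⟩ := abs_le.1 (hξ i)
    have hR : ((c (Sum.inr i) + w (Sum.inr i) : ℤ) : ℝ) / SC ≤ 1 / 4 := by
      rw [← rootW_div]; exact div_le_div_of_nonneg_right (by exact_mod_cast hi) hS.le
    have hR' : -(1 : ℝ) / 4 ≤ ((c (Sum.inr i) - w (Sum.inr i) : ℤ) : ℝ) / SC := by
      have : ((-70368744177664 : ℤ) : ℝ) / SC ≤ ((c (Sum.inr i) - w (Sum.inr i) : ℤ) : ℝ) / SC :=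
        div_le_div_of_nonneg_right (by exact_mod_cast hi') hS.le
      have e : ((-70368744177664 : ℤ) : ℝ) / SC = -(1 : ℝ) / 4 := by
        rw [show ((-70368744177664 : ℤ) : ℝ) = -((70368744177664 : ℤ) : ℝ) by push_cast; ring, neg_div, rootW_div]; ring
      rwa [e] at this
    push_cast at hR hR'
    rw [add_div] at hR; rw [sub_div] at hR'
    rw [abs_le]; constructor <;> linarith
  intro i; fin_cases i
  · exact key 0 h0 h0'
  · exact key 1 h1 h1'
  · exact key 2 h2 h2'

/-- ★ **THE hcp TABLE VERDICT on an entry/shuffle box, ANY table** `tab` at derivative half-width `E`: guard ∧ the hcp table leaf checker on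
`tabLH c w` with the DOUBLED target `2μ` (cancelling the `±`-half-set factor of hand-1's final inequality). -/
def tableLeafOKHW (tab : QT) (E : ℕ) (μ : ℤ) (c w : (Fin 3 × Fin 3) ⊕ Fin 3 → ℤ) : Bool :=
  shufInOK c w && leafCheckH tab nearLabelsH E tabHA0 tabHA1 tabHA2 tabHA3 tabHA4 tabHA5 tabHA6 tabHA7 tabHA8 tabHA9 (tabLH c w)
    (decide (μ < 0)) (2 * μ.natAbs)

/-- ★ The hcp table verdict with hand-1's v2 table `qTable` / `tabE`. -/
def tableLeafOKH (μ : ℤ) (c w : (Fin 3 × Fin 3) ⊕ Fin 3 → ℤ) : Bool := tableLeafOKHW qTable tabE μ c w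

/-- `sgnZ (μ < 0) (2|μ|) = 2μ`. [formal bookkeeping] -/
theorem sgnZ_two_natAbs (μ : ℤ) : sgnZ (decide (μ < 0)) (2 * μ.natAbs) = 2 * μ := by
  by_cases h : μ < 0
  · simp only [h, decide_true, sgnZ]; omega
  · simp only [h, decide_false, sgnZ]; omega

/-- ★★ **SOUNDNESS OF THE hcp TABLE VERDICT (any semantically certified table)** in the `hver` shape of `…HomEntryGramHcp.hcpHalf_of_entryTree`: for
every `U` with `‖U − 1‖ ≤ 1/4` and every `ξ` with entries / shuffle in the box, the floor disjunct holds — by `boxSumH_ge_of_leafCheckH_sem`. [folklore] -/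
theorem tableLeafOKHW_sound {tab : QT} {E : ℕ} (htab : TabSem E tab) {μ : ℤ} {c w : (Fin 3 × Fin 3) ⊕ Fin 3 → ℤ}
    (h : tableLeafOKHW tab E μ c w = true) (U : E3 →L[ℝ] E3) (ξ : E3) (_hsa : ∀ v v' : E3, ⟪U v, v'⟫ = ⟪v, U v'⟫) (hU : ‖U - 1‖ ≤ 1 / 4)
    (hbox : ∀ ab : Fin 3 × Fin 3, |(U (EuclideanSpace.single ab.2 (1 : ℝ))) ab.1 - (c (Sum.inl ab) : ℝ) / SC| ≤ (w (Sum.inl ab) : ℝ) / SC)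
    (hξ : ∀ i : Fin 3, |ξ i - (c (Sum.inr i) : ℝ) / SC| ≤ (w (Sum.inr i) : ℝ) / SC) :
    (∀ (M : ℕ) (z : Fin M → E3) (c : Fin M), Function.Injective z →
        Set.range z = {x : E3 | dist x (z c) ≤ 133 / 10 ∧ ∃ a : Fin 3 → ℤ,
          x = z c + latPt U hexFrame a ∨ x = z c + latPt U hexFrame a + U (hcpShift + ξ)} →
        TightNearCap (9 / 5) (3 / 2) z c ∨ ExemptNear (9 / 5) ExRec z c ∨ BadNearCap (9 / 5) (3 / 2) z c) ∨
      (μ : ℝ) / SC ≤ ∑ b ∈ (Fintype.piFinset fun _ : Fin 3 => Finset.Icc (-7 : ℤ) 7).filter (fun b => b ≠ 0), effPot w₄₅ ω₄ (3 / 400) ‖latPt U hexFrame b‖ +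
        ∑ b ∈ (Fintype.piFinset fun _ : Fin 3 => Finset.Icc (-7 : ℤ) 7), effPot w₄₅ ω₄ (3 / 400) ‖latPt U hexFrame b + U (hcpShift + ξ)‖ := by
  simp only [tableLeafOKHW, Bool.and_eq_true] at h
  obtain ⟨hin, hleaf⟩ := h
  refine Or.inr ?_
  have key := boxSumH_ge_of_leafCheckH_sem htab hleaf U hU ξ (abs_le_of_shufInOK hin hξ) (tabLH_mem_box U ξ hbox hξ)
  rw [sgnZ_two_natAbs] at key
  push_cast at key
  have e : 2 * (μ : ℝ) / SC / 2 = (μ : ℝ) / SC := by ring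
  rw [e] at key
  exact key

/-! ## §3. The nine-coordinate driver, the verdict of record v5, and ★★★ `(H)` -/

/-- ★ The table verdict through the mirror `symH` (lower triangle read from the upper; the nine free hcp entry coordinates), any table. -/
def entryLeafOKHTW (tab : QT) (E : ℕ) (μ : ℤ) (c w : (Fin 3 × Fin 3) ⊕ Fin 3 → ℤ) : Bool := tableLeafOKHW tab E μ (symH c) (symH w)

/-- ★ **hcp VERDICT v5, any table**: shuffle-sign prune ∨ radial prune (mirror) ∨ TABLE (mirror) ∨ v4 rest (`entryLeafOKH3R μ`: sharp fit ∨ fit ∨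
symmetry ∨ column ∨ (P4)) — cheap disjuncts first, the expensive (P4) box checker last. -/
def entryLeafOKH3RDTW (tab : QT) (E : ℕ) (μ : ℤ) (c w : (Fin 3 × Fin 3) ⊕ Fin 3 → ℤ) : Bool :=
  shufOut c w || radOKH (symH c) (symH w) || entryLeafOKHTW tab E μ c w || entryLeafOKH3R μ c w

/-- ★ **hcp VERDICT OF RECORD v5** (hand-1's v2 table `qTable`; swap in the v3 "K" table by `entryLeafOKH3RDTW`). -/
def entryLeafOKH3RDT (μ : ℤ) (c w : (Fin 3 × Fin 3) ⊕ Fin 3 → ℤ) : Bool := entryLeafOKH3RDTW qTable tabE μ c w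

/-- ★ Soundness of `entryLeafOKH3RDTW` relative to the fundamental domain (the `hver` shape of `…HomEntryFlipHcp.hcpHalf_of_entrySearchShuf`). [folklore] -/
theorem entryLeafOKH3RDTW_sound {tab : QT} {E : ℕ} (htab : TabSem E tab) {μ : ℤ} {c w : (Fin 3 × Fin 3) ⊕ Fin 3 → ℤ}
    (h : entryLeafOKH3RDTW tab E μ c w = true) (U : E3 →L[ℝ] E3) (ξ : E3)
    (hsa : ∀ v v' : E3, ⟪U v, v'⟫ = ⟪v, U v'⟫) (hU : ‖U - 1‖ ≤ 1 / 4)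
    (hbox : ∀ ab : Fin 3 × Fin 3, |(U (EuclideanSpace.single ab.2 (1 : ℝ))) ab.1 - (c (Sum.inl ab) : ℝ) / SC| ≤ (w (Sum.inl ab) : ℝ) / SC)
    (hξ : ∀ i : Fin 3, |ξ i - (c (Sum.inr i) : ℝ) / SC| ≤ (w (Sum.inr i) : ℝ) / SC) (h0 : 0 ≤ ξ 0) (h2 : 0 ≤ ξ 2) :
    (∀ (M : ℕ) (z : Fin M → E3) (c : Fin M), Function.Injective z →
        Set.range z = {x : E3 | dist x (z c) ≤ 133 / 10 ∧ ∃ a : Fin 3 → ℤ,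
          x = z c + latPt U hexFrame a ∨ x = z c + latPt U hexFrame a + U (hcpShift + ξ)} →
        TightNearCap (9 / 5) (3 / 2) z c ∨ ExemptNear (9 / 5) ExRec z c ∨ BadNearCap (9 / 5) (3 / 2) z c) ∨
      (μ : ℝ) / SC ≤ ∑ b ∈ (Fintype.piFinset fun _ : Fin 3 => Finset.Icc (-7 : ℤ) 7).filter (fun b => b ≠ 0), effPot w₄₅ ω₄ (3 / 400) ‖latPt U hexFrame b‖ +
        ∑ b ∈ (Fintype.piFinset fun _ : Fin 3 => Finset.Icc (-7 : ℤ) 7), effPot w₄₅ ω₄ (3 / 400) ‖latPt U hexFrame b + U (hcpShift + ξ)‖ := by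
  simp only [entryLeafOKH3RDTW, entryLeafOKHTW, Bool.or_eq_true] at h
  rcases h with ((h | h) | h) | h
  · exact (false_of_shufOut h hξ h0 h2).elim
  · exact Or.inl (radOKH_sound h U ξ hU (hbox_symU hsa hbox) hξ)
  · exact tableLeafOKHW_sound htab h U ξ hsa hU (hbox_symU hsa hbox) hξ
  · exact entryLeafOKH3R_sound h U ξ hsa hU hbox hξ

/-- ★★ **THE hcp HALF FROM ONE SEARCH BOOLEAN with `entryLeafOKH3RDTW tab E μ`** (any semantically certified table). [folklore] -/
theorem hcpHalf_of_entrySearchH3RDTW {tab : QT} {E : ℕ} (htab : TabSem E tab) {m : ℝ} {μ : ℤ}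
    (hμ : 2 * (m + (-(7175 / 10000) + 3 / 400)) * SC ≤ μ)
    {sel : ℕ → ((Fin 3 × Fin 3) ⊕ Fin 3 → ℤ) → ((Fin 3 × Fin 3) ⊕ Fin 3 → ℤ) → (Fin 3 × Fin 3) ⊕ Fin 3} {fuel d : ℕ}
    (h : searchOK (entryLeafOKH3RDTW tab E μ) sel fuel d rootCH rootWH = true) :
    ∀ (U : E3 →L[ℝ] E3) (ξ : E3), (∀ v w : E3, inner ℝ (U v) w = inner ℝ v (U w)) → (∀ w : E3, 0 ≤ inner ℝ w (U w)) →
      ‖U - 1‖ ≤ 1 / 4 → ‖ξ‖ ≤ 1 / 4 → HcpDich m U ξ :=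
  hcpHalf_of_entrySearchShuf hμ (entryLeafOKH3RDTW tab E μ)
    (fun _ _ hv U ξ hsa hU hbox hξ h0 h2 => entryLeafOKH3RDTW_sound htab hv U ξ hsa hU hbox hξ h0 h2) h

/-- ★★ The same for the verdict of record `entryLeafOKH3RDT μ` (v2 table). [folklore] -/
theorem hcpHalf_of_entrySearchH3RDT {m : ℝ} {μ : ℤ} (hμ : 2 * (m + (-(7175 / 10000) + 3 / 400)) * SC ≤ μ)
    {sel : ℕ → ((Fin 3 × Fin 3) ⊕ Fin 3 → ℤ) → ((Fin 3 × Fin 3) ⊕ Fin 3 → ℤ) → (Fin 3 × Fin 3) ⊕ Fin 3} {fuel d : ℕ}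
    (h : searchOK (entryLeafOKH3RDT μ) sel fuel d rootCH rootWH = true) :
    ∀ (U : E3 →L[ℝ] E3) (ξ : E3), (∀ v w : E3, inner ℝ (U v) w = inner ℝ v (U w)) → (∀ w : E3, 0 ≤ inner ℝ w (U w)) →
      ‖U - 1‖ ≤ 1 / 4 → ‖ξ‖ ≤ 1 / 4 → HcpDich m U ξ :=
  hcpHalf_of_entrySearchH3RDTW (tabSem_of_allOK qTable_allOK) hμ h

/-- ★★★ **`(H) HomFloor m` from the fcc search of record and ONE hcp search with ANY semantically certified table** (`htab`; v3: `tabSem_of_allOKK …`).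
[folklore] -/
theorem homFloor_of_entrySearches6RB3RDTW {tab : QT} {E : ℕ} (htab : TabSem E tab) {m : ℝ} {μ : ℤ}
    (hμ : 2 * (m + (-(7175 / 10000) + 3 / 400)) * SC ≤ μ)
    {selF : ℕ → (Fin 3 × Fin 3 → ℤ) → (Fin 3 × Fin 3 → ℤ) → Fin 3 × Fin 3} {fuelF dF : ℕ}
    (hF : searchOK (entryLeafOK6RB μ) selF fuelF dF rootC rootW = true)
    {selH : ℕ → ((Fin 3 × Fin 3) ⊕ Fin 3 → ℤ) → ((Fin 3 × Fin 3) ⊕ Fin 3 → ℤ) → (Fin 3 × Fin 3) ⊕ Fin 3} {fuelH dH : ℕ}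
    (hH : searchOK (entryLeafOKH3RDTW tab E μ) selH fuelH dH rootCH rootWH = true) : HomFloor m :=
  homFloor_of_prunedBoxSums_selfAdjoint (fccHalf_of_entrySearch6RB hμ hF) (hcpHalf_of_entrySearchH3RDTW htab hμ hH)

/-- ★★★ **`(H) HomFloor m`, TARGET CERTIFICATE v5** — fcc: `entryLeafOK6RB μ` (radial ∨ fundamental domain ×24 × best fit, six coordinates); hcp:
`entryLeafOKH3RDT μ` (fundamental domain ×4, radial, hcp TABLE, sharp fit, nine coordinates); every `m`, `μ` with `2 (m + e_W) SC ≤ μ`, any selectors.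
[folklore] -/
theorem homFloor_of_entrySearches6RB3RDT {m : ℝ} {μ : ℤ} (hμ : 2 * (m + (-(7175 / 10000) + 3 / 400)) * SC ≤ μ)
    {selF : ℕ → (Fin 3 × Fin 3 → ℤ) → (Fin 3 × Fin 3 → ℤ) → Fin 3 × Fin 3} {fuelF dF : ℕ}
    (hF : searchOK (entryLeafOK6RB μ) selF fuelF dF rootC rootW = true)
    {selH : ℕ → ((Fin 3 × Fin 3) ⊕ Fin 3 → ℤ) → ((Fin 3 × Fin 3) ⊕ Fin 3 → ℤ) → (Fin 3 × Fin 3) ⊕ Fin 3} {fuelH dH : ℕ}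
    (hH : searchOK (entryLeafOKH3RDT μ) selH fuelH dH rootCH rootWH = true) : HomFloor m :=
  homFloor_of_prunedBoxSums_selfAdjoint (fccHalf_of_entrySearch6RB hμ hF) (hcpHalf_of_entrySearchH3RDT hμ hH)

/-- ★★★ `HomFloor (1/625)` — v5, at `muRec`. [folklore] -/
theorem homFloor_625_of_entrySearches6RB3RDT
    {selF : ℕ → (Fin 3 × Fin 3 → ℤ) → (Fin 3 × Fin 3 → ℤ) → Fin 3 × Fin 3} {fuelF dF : ℕ}
    (hF : searchOK (entryLeafOK6RB muRec) selF fuelF dF rootC rootW = true)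
    {selH : ℕ → ((Fin 3 × Fin 3) ⊕ Fin 3 → ℤ) → ((Fin 3 × Fin 3) ⊕ Fin 3 → ℤ) → (Fin 3 × Fin 3) ⊕ Fin 3} {fuelH dH : ℕ}
    (hH : searchOK (entryLeafOKH3RDT muRec) selH fuelH dH rootCH rootWH = true) : HomFloor (1 / 625) :=
  homFloor_of_entrySearches6RB3RDT muRec_ok hF hH

/-- ★★★ `HomFloor (1/1000)` — v5, at `muMilli`. [folklore] -/
theorem homFloor_milli_of_entrySearches6RB3RDT
    {selF : ℕ → (Fin 3 × Fin 3 → ℤ) → (Fin 3 × Fin 3 → ℤ) → Fin 3 × Fin 3} {fuelF dF : ℕ}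
    (hF : searchOK (entryLeafOK6RB muMilli) selF fuelF dF rootC rootW = true)
    {selH : ℕ → ((Fin 3 × Fin 3) ⊕ Fin 3 → ℤ) → ((Fin 3 × Fin 3) ⊕ Fin 3 → ℤ) → (Fin 3 × Fin 3) ⊕ Fin 3} {fuelH dH : ℕ}
    (hH : searchOK (entryLeafOKH3RDT muMilli) selH fuelH dH rootCH rootWH = true) : HomFloor (1 / 1000) :=
  homFloor_of_entrySearches6RB3RDT muMilli_ok hF hH

/-- ★★★ `HomFloor (1/625)` with the fcc radial-only verdict `entryLeafOK6R` (v4's first fcc verdict) × hcp v5. [folklore] -/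
theorem homFloor_625_of_entrySearches6R3RDT
    {selF : ℕ → (Fin 3 × Fin 3 → ℤ) → (Fin 3 × Fin 3 → ℤ) → Fin 3 × Fin 3} {fuelF dF : ℕ}
    (hF : searchOK (entryLeafOK6R muRec) selF fuelF dF rootC rootW = true)
    {selH : ℕ → ((Fin 3 × Fin 3) ⊕ Fin 3 → ℤ) → ((Fin 3 × Fin 3) ⊕ Fin 3 → ℤ) → (Fin 3 × Fin 3) ⊕ Fin 3} {fuelH dH : ℕ}
    (hH : searchOK (entryLeafOKH3RDT muRec) selH fuelH dH rootCH rootWH = true) : HomFloor (1 / 625) :=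
  homFloor_of_prunedBoxSums_selfAdjoint (fccHalf_of_entrySearch6R muRec_ok hF) (hcpHalf_of_entrySearchH3RDT muRec_ok hH)

/-! ## §4. The TIERED verdict over hand-1's v3 "K" tables (ρ-relative curvature ranges .03 / .06 / .12 / .24) -/

/-- ★ **hcp VERDICT v5K**: shuffle-sign prune ∨ radial prune (mirror) ∨ hcp TABLE on `qTableK1` ∨ `qTableK2` ∨ `qTableK3` ∨ `qTableK4` (mirror; tier-OR,
tight tier first) ∨ v4 rest `entryLeafOKH3R μ`.  All four K tables and their `allOKK` certificates are hand-1 g22's (in the tree). -/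
def entryLeafOKH3RDTK (μ : ℤ) (c w : (Fin 3 × Fin 3) ⊕ Fin 3 → ℤ) : Bool :=
  shufOut c w || radOKH (symH c) (symH w) || entryLeafOKHTW qTableK1 tabE μ c w || entryLeafOKHTW qTableK2 tabE μ c w ||
    entryLeafOKHTW qTableK3 tabE μ c w || entryLeafOKHTW qTableK4 tabE μ c w || entryLeafOKH3R μ c w

/-- ★ Soundness of `entryLeafOKH3RDTK` relative to the fundamental domain. [folklore] -/
theorem entryLeafOKH3RDTK_sound {μ : ℤ} {c w : (Fin 3 × Fin 3) ⊕ Fin 3 → ℤ} (h : entryLeafOKH3RDTK μ c w = true) (U : E3 →L[ℝ] E3) (ξ : E3)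
    (hsa : ∀ v v' : E3, ⟪U v, v'⟫ = ⟪v, U v'⟫) (hU : ‖U - 1‖ ≤ 1 / 4)
    (hbox : ∀ ab : Fin 3 × Fin 3, |(U (EuclideanSpace.single ab.2 (1 : ℝ))) ab.1 - (c (Sum.inl ab) : ℝ) / SC| ≤ (w (Sum.inl ab) : ℝ) / SC)
    (hξ : ∀ i : Fin 3, |ξ i - (c (Sum.inr i) : ℝ) / SC| ≤ (w (Sum.inr i) : ℝ) / SC) (h0 : 0 ≤ ξ 0) (h2 : 0 ≤ ξ 2) :
    (∀ (M : ℕ) (z : Fin M → E3) (c : Fin M), Function.Injective z →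
        Set.range z = {x : E3 | dist x (z c) ≤ 133 / 10 ∧ ∃ a : Fin 3 → ℤ,
          x = z c + latPt U hexFrame a ∨ x = z c + latPt U hexFrame a + U (hcpShift + ξ)} →
        TightNearCap (9 / 5) (3 / 2) z c ∨ ExemptNear (9 / 5) ExRec z c ∨ BadNearCap (9 / 5) (3 / 2) z c) ∨
      (μ : ℝ) / SC ≤ ∑ b ∈ (Fintype.piFinset fun _ : Fin 3 => Finset.Icc (-7 : ℤ) 7).filter (fun b => b ≠ 0), effPot w₄₅ ω₄ (3 / 400) ‖latPt U hexFrame b‖ +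
        ∑ b ∈ (Fintype.piFinset fun _ : Fin 3 => Finset.Icc (-7 : ℤ) 7), effPot w₄₅ ω₄ (3 / 400) ‖latPt U hexFrame b + U (hcpShift + ξ)‖ := by
  simp only [entryLeafOKH3RDTK, entryLeafOKHTW, Bool.or_eq_true] at h
  rcases h with (((((h | h) | h) | h) | h) | h) | h
  · exact (false_of_shufOut h hξ h0 h2).elim
  · exact Or.inl (radOKH_sound h U ξ hU (hbox_symU hsa hbox) hξ)
  · exact tableLeafOKHW_sound (tabSem_of_allOKK qTableK1_allOKK) h U ξ hsa hU (hbox_symU hsa hbox) hξ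
  · exact tableLeafOKHW_sound (tabSem_of_allOKK qTableK2_allOKK) h U ξ hsa hU (hbox_symU hsa hbox) hξ
  · exact tableLeafOKHW_sound (tabSem_of_allOKK qTableK3_allOKK) h U ξ hsa hU (hbox_symU hsa hbox) hξ
  · exact tableLeafOKHW_sound (tabSem_of_allOKK qTableK4_allOKK) h U ξ hsa hU (hbox_symU hsa hbox) hξ
  · exact entryLeafOKH3R_sound h U ξ hsa hU hbox hξ

/-- ★★ **THE hcp HALF FROM ONE SEARCH BOOLEAN with the tiered verdict `entryLeafOKH3RDTK μ`.** [folklore] -/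
theorem hcpHalf_of_entrySearchH3RDTK {m : ℝ} {μ : ℤ} (hμ : 2 * (m + (-(7175 / 10000) + 3 / 400)) * SC ≤ μ)
    {sel : ℕ → ((Fin 3 × Fin 3) ⊕ Fin 3 → ℤ) → ((Fin 3 × Fin 3) ⊕ Fin 3 → ℤ) → (Fin 3 × Fin 3) ⊕ Fin 3} {fuel d : ℕ}
    (h : searchOK (entryLeafOKH3RDTK μ) sel fuel d rootCH rootWH = true) :
    ∀ (U : E3 →L[ℝ] E3) (ξ : E3), (∀ v w : E3, inner ℝ (U v) w = inner ℝ v (U w)) → (∀ w : E3, 0 ≤ inner ℝ w (U w)) →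
      ‖U - 1‖ ≤ 1 / 4 → ‖ξ‖ ≤ 1 / 4 → HcpDich m U ξ :=
  hcpHalf_of_entrySearchShuf hμ (entryLeafOKH3RDTK μ) (fun _ _ hv U ξ hsa hU hbox hξ h0 h2 => entryLeafOKH3RDTK_sound hv U ξ hsa hU hbox hξ h0 h2) h

/-- ★★★ **`(H) HomFloor (1/625)`, TARGET CERTIFICATE v5K** — fcc verdict of record `entryLeafOK6RB muRec` × hcp TIERED table verdict `entryLeafOKH3RDTK muRec`
(any selectors; the fcc K verdict of hand-1's `…EntryTableK`, when landed, pairs with `hcpHalf_of_entrySearchH3RDTK` through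
`homFloor_of_prunedBoxSums_selfAdjoint` in one line). [folklore] -/
theorem homFloor_625_of_entrySearches6RB3RDTK
    {selF : ℕ → (Fin 3 × Fin 3 → ℤ) → (Fin 3 × Fin 3 → ℤ) → Fin 3 × Fin 3} {fuelF dF : ℕ}
    (hF : searchOK (entryLeafOK6RB muRec) selF fuelF dF rootC rootW = true)
    {selH : ℕ → ((Fin 3 × Fin 3) ⊕ Fin 3 → ℤ) → ((Fin 3 × Fin 3) ⊕ Fin 3 → ℤ) → (Fin 3 × Fin 3) ⊕ Fin 3} {fuelH dH : ℕ}
    (hH : searchOK (entryLeafOKH3RDTK muRec) selH fuelH dH rootCH rootWH = true) : HomFloor (1 / 625) :=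
  homFloor_of_prunedBoxSums_selfAdjoint (fccHalf_of_entrySearch6RB muRec_ok hF) (hcpHalf_of_entrySearchH3RDTK muRec_ok hH)

/-- ★★★ `HomFloor (1/1000)` — v5K at `muMilli`. [folklore] -/
theorem homFloor_milli_of_entrySearches6RB3RDTK
    {selF : ℕ → (Fin 3 × Fin 3 → ℤ) → (Fin 3 × Fin 3 → ℤ) → Fin 3 × Fin 3} {fuelF dF : ℕ}
    (hF : searchOK (entryLeafOK6RB muMilli) selF fuelF dF rootC rootW = true)
    {selH : ℕ → ((Fin 3 × Fin 3) ⊕ Fin 3 → ℤ) → ((Fin 3 × Fin 3) ⊕ Fin 3 → ℤ) → (Fin 3 × Fin 3) ⊕ Fin 3} {fuelH dH : ℕ}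
    (hH : searchOK (entryLeafOKH3RDTK muMilli) selH fuelH dH rootCH rootWH = true) : HomFloor (1 / 1000) :=
  homFloor_of_prunedBoxSums_selfAdjoint (fccHalf_of_entrySearch6RB muMilli_ok hF) (hcpHalf_of_entrySearchH3RDTK muMilli_ok hH)

/-! ## §5. Kernel smoke test -/

/-- At the identity-hcp thin box (`U = 1`, `ξ = 0`): the v2-table leaf accepts entry half-width `2⁻¹⁴` (`2^34`), hand-1's tier-1 K table accepts
`2⁻¹²` (`2^36`) — each a full 1404-label fold in the kernel (≈ 3 s); the pilot table (native) is in the hand-2 g24 memo. -/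
example : tableLeafOKH muRec rootCH (fun _ => 17179869184) = true ∧ tableLeafOKHW qTableK1 tabE muRec rootCH (fun _ => 68719476736) = true := by
  decide +kernel

end Summit.AtomisticToContinuum.Crystallization.Theorems.FrustratedLawDichotomyStrainedPatchHomEntryTableHcp
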